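import Summits.HodgeConjecture.HodgeConjecture.Theorems.Ring2AbelianAllAndrePrimitiveLiftLefschetzDegree
import Summits.HodgeConjecture.HodgeConjecture.Theorems.Ring2AbelianAllAndrePrimitiveLiftRows
import HarnessLib

/-!
# Ring 2 · sub-cell AbelianAll (ALL ABELIAN VARIETIES), André axis, part XXIII-f — THE SHARPEST FORM: the primitive lift (Prim)_t(r) from the
# clause of `A_r(𝒳, K)` ON THE GYSIN IMAGES OF THE PRIMITIVE INVARIANT ALGEBRAIC CLASSES OF THE FIBRE ONLY; W₆: the Weil 3-cycles of `E⁶`, viewed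
# in the sevenfold total space, must be homologically hyperplane sections of algebraic 4-cycles

HONEST FRAMING (page 1, verbatim): **research route, not a corollary; conditional on HC_CM plus one named
minimal statement.** Cell line: research route conditional on HC_CM; not a corollary; Q11.4-sentence-2
already refuted in dim ≥ 3. Nothing in this file proves a case of the Hodge conjecture for an abelian variety; `HC_CM` does not occur in this
file (it is IDLE on the `E`-power row); item `Theses.RankFourFaces.CMToAbelian` (stmt-16267) OPEN and not closed here; `(W_E)₃`
(`CMPowerAnchoredCompactWeilPencilsAt 3`, part IX) is an OPEN habitat node used as a hypothesis. Seat `pub-hodge-ring2-ab-andre-2`, gen 15; brief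
(iii) "smallest open instance stated as a find-the-cycle problem; partial results as theorems".

## What part XXIII-c's proof really uses (`f : 𝒳 ⟶ S` compact pencil of abelian `d`-folds, `t` any point, `K = D.Hη`, `κ = j_t^*K`, `2(p+1)+m = d`)

The clause `A_{p+1}(𝒳, K)` (`L_K^{m+1} : N^{p+1}(𝒳) → N^{p+1+m+1}(𝒳)` onto) entered only through "`M W = (L_K^{m+1})⁻¹ j_* L_κᵐ j^*W` is
algebraic when `j^*W` is". Splitting `j^*W = pr(j^*W) + κ ∪ j^*a` with `a ∈ Nᵖ(𝒳)` algebraic (§1: Lefschetz decomposition, Deligne's invariance of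
the primitive parts, Kleiman's algebraicity of the components, the lift (L)_t(p) one degree below), the coprimitive half costs nothing:
`(L_K^{m+1})⁻¹ j_* L_κᵐ(κ ∪ j^*a) = (L_K^{m+1})⁻¹([X_t] ∪ L_K^{m+1} a) = [X_t] ∪ a` is algebraic. So the only input from the non-abelian total
space is the FIBRE-SUPPORTED CLAUSE: for every `κ`-PRIMITIVE invariant algebraic `ξ ∈ H^{2p+2}(X_t)`, the (unique, by hard Lefschetz) class
`x ∈ H^{2p+2}(𝒳)` with `L_K^{m+1} x = j_{t*}(L_κᵐ ξ)` is ALGEBRAIC.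

## What is proved (theorems only; no definition, no named fact, no sorry; `HC_CM` absent)

§1 **`exists_coprimitive_eq_map_lefschetzPowTo`** — `j^*W = pr(j^*W) + j^*(L_K a)`, `a ∈ Nᵖ(𝒳)`, for `j^*W ∈ N^{p+1}(X_t)` (granted (L)_t(p) and
Kleiman's clause of the fibre below `p+1`). §2 **`primitiveLift_succ_of_fibreLefschetzDegree`** — (L)_t(p) ∧ [clause of the fibre below `p+1`] ∧
[fibre-supported clause] ⟹ (Prim)_t(p+1) (the proof of part XXIII-c verbatim with step (1) replaced; implies XXIII-c's theorem). §3
**`primitiveLift_succ_of_fibreLefschetzDegree'`** (fibre clause discharged by Lieberman), **`forall_comap_le_sup_of_rankOne_of_fibreLefschetzDegree_three`**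
(W₆: rank-one `H⁴`-invariants ∧ [for every `κ`-primitive invariant algebraic `ξ ∈ H⁶(X_t)`: `j_{t*}ξ = K ∪ x`, `x ∈ N³(𝒳⁷)`] ⟹ the lift in every degree
at `t`), **`weilSixfolds_of_cmPowerWeilPencilsAt_of_rankOne_of_fibreLefschetzDegree_three`** (`(W_E)₃ ∧ [that, at the E-power points] ⟹ WeilSixfolds`, K,
`HC_CM` idle).

THE FIND-THE-CYCLE PROBLEM OF THE ANDRÉ AXIS, SHARPEST FORM (RING2-MAP §AbelianAll gen 15): on a compact Weil-type pencil of abelian sixfolds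
`𝒳⁷ → S` with large monodromy and an `E`-power fibre `X_t ≅ E⁶`, let `w₁, w₂` be the `κ`-primitive projections of the two Weil classes of `X_t`
(explicit algebraic 3-cycles on `E⁶`, van Geemen Thm. 6.12); show that each `j_{t*}w_i ∈ H⁸(𝒳)` — the class of that 3-cycle IN THE SEVENFOLD — is
`K ∪ [Y_i]` for an algebraic 4-cycle `Y_i` of `𝒳` (`K` a hyperplane class of `𝒳`). Granted this and `(W_E)₃`, the Weil classes of all sixfolds of
the pencil's reach are algebraic. Honest status: the clause is implied by `A₃(𝒳, K)` and by the Hodge conjecture for `𝒳`; it is NOT known to follow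
from `HC_AV`, and it is not equivalent to the lift (given the lift `w = j^*x`, `x` algebraic, one has `j_*w = [X_t] ∪ x`, not `K ∪ x`); nothing is
minimal; no node is born.

References: Grothendieck1968 (§3 p. 196); Kleiman1968AlgebraicCycles (§3); Lieberman1968 (Thm. 1); VoisinHodgeI2002 (§6.2.3 Cor. 6.26, §6.3.2
Thm. 6.32); VoisinHodgeII2003 (Thm. 4.18, Prop. 9.20); vanGeemen1994HodgeAV (Thm. 4.3, 5.12, 6.12); Andre1996Motifs (§6.3, Lemme 6.3.3).
-/

noncomputable section

set_option linter.dupNamespace false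

namespace Summit.HodgeConjecture.HodgeConjecture.Ring2.AbelianAll

open CategoryTheory AlgebraicGeometry
open Literature.AlgebraicGeometry Literature.AlgebraicGeometry.Motives
open Literature.AlgebraicGeometry.HodgeTheory
open Literature.AlgebraicTopology.SingularHomology (singularCohomology cupProduct cupProduct_map)
open Literature.Geometry.Kaehler (lefschetzOperator lefschetzPow HasHardLefschetzProperty)

/-! ## §1 The coprimitive part of an invariant algebraic class is `κ ∪ j^*(algebraic)` -/

section Main

variable {𝒳 S : SchemeOver ℂ} {d : ℕ} {f : 𝒳 ⟶ S}

/-- **The coprimitive part of an invariant algebraic class is `j^*(K ∪ a)` with `a` ALGEBRAIC** — granted (L)_t(p) and Kleiman's clause of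
the fibre below `p + 1`: for `W ∈ H^{2p+2}(𝒳)` with `j^*W ∈ N^{p+1}(X_t)`, `j^*W = pr(j^*W) + j^*(L_K a)` for some `a ∈ Nᵖ(𝒳)` (each Lefschetz
component `L^{s+1}ξ_{(a,s+1)}` of `j^*W` is `κ ∪ j^*a'` with `a'` algebraic: Deligne's invariance of the primitive parts, Kleiman's algebraicity
of the components, and (L)_t(p); part XXI-a §1 / XXIII-b §5). [cite: VoisinHodgeI2002, §6.2.3 Cor. 6.26] [cite: VoisinHodgeII2003, §4.3.1 Thm. 4.18]
[cite: Kleiman1968AlgebraicCycles, §3 (proof of Prop. 3.8)] -/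
theorem exists_coprimitive_eq_map_lefschetzPowTo (hf : IsCompactAbelianPencil f d) (t : ComplexPoints S)
    {K : complexBetti 𝒳 2}
    (hK : ∀ s : ComplexPoints S, HasHardLefschetzProperty (complexBetti.map (fiberι f s) 2 K) d)
    (hKt : IsPolarizationClass d (fiberOver f t) (complexBetti.map (fiberι f t) 2 K)) {p : ℕ}
    (hA : ∀ (p' r' q' : ℕ), p' < p + 1 → p' + (p + 1) ≤ d → 2 * p' + r' = d → p' + r' = q' →
      Set.SurjOn (lefschetzPow (complexBetti.map (fiberι f t) 2 K) r' (2 * p'))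
        (algebraicClasses (fiberOver f t) p' : Set (complexBetti (fiberOver f t) (2 * p')))
        (supportedClasses (fiberOver f t) (2 * p' + 2 * r') q'))
    (hprev : (algebraicClasses (fiberOver f t) p).comap (complexBetti.map (fiberι f t) (2 * p)).hom ≤
      algebraicClasses 𝒳 p ⊔ LinearMap.ker (complexBetti.map (fiberι f t) (2 * p)).hom)
    (W : complexBetti 𝒳 (2 * (p + 1))) (hW : complexBetti.map (fiberι f t) (2 * (p + 1)) W ∈ algebraicClasses (fiberOver f t) (p + 1)) :
    ∃ a ∈ algebraicClasses 𝒳 p, complexBetti.map (fiberι f t) (2 * (p + 1)) W =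
      primitivePart (complexBetti.map (fiberι f t) 2 K) d (hK t) (hvan_fiberOver hf t) ⟨(2 * (p + 1), 0), by omega⟩
          (complexBetti.map (fiberι f t) (2 * (p + 1)) W) +
        complexBetti.map (fiberι f t) (2 * (p + 1)) (lefschetzPowTo K 1 (2 * p) (2 * (p + 1)) (by omega) a) := by
  classical
  have hXt := hf.isSmoothProjective_fiberOver t
  set κ := complexBetti.map (fiberι f t) 2 K with hκdef
  set ξ := complexBetti.map (fiberι f t) (2 * (p + 1)) W with hξdef
  set top : {P : ℕ × ℕ // P.1 + 2 * P.2 = 2 * (p + 1)} := ⟨(2 * (p + 1), 0), by omega⟩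
  have h2 : 2 * p + 2 * 1 = 2 * (p + 1) := by ring
  -- every NON-top Lefschetz component of `ξ` is `j^*(L_K a')` with `a'` algebraic
  have hcomp : ∀ P : {P : ℕ × ℕ // P.1 + 2 * P.2 = 2 * (p + 1)}, ∃ a' ∈ algebraicClasses 𝒳 p, P ≠ top →
      lefschetzPowTo κ P.1.2 P.1.1 (2 * (p + 1)) P.2 (primitivePart κ d (hK t) (hvan_fiberOver hf t) P ξ) =
        complexBetti.map (fiberι f t) (2 * (p + 1)) (lefschetzPowTo K 1 (2 * p) (2 * (p + 1)) h2 a') := by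
    intro P
    by_cases hPtop : P = top
    · exact ⟨0, Submodule.zero_mem _, fun h ↦ absurd hPtop h⟩
    have hPalg : primitivePart κ d (hK t) (hvan_fiberOver hf t) P ξ ∈
        supportedClasses (fiberOver f t) P.1.1 (p + 1 - P.1.2) :=
      primitivePart_mem_supportedClasses_of_surjOn_lt hXt hKt.mem_algebraicClasses (hK t) (hvan_fiberOver hf t)
        (p + 1) hA ξ hW P
    obtain ⟨B, hB⟩ : ∃ B : complexBetti 𝒳 P.1.1,
        primitivePart κ d (hK t) (hvan_fiberOver hf t) P ξ = complexBetti.map (fiberι f t) P.1.1 B :=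
      exists_primitivePart_map_fiberι_eq deligne1968_invariantClass_fromTotalSpace_holds hf K hK W P t
    obtain ⟨⟨a, s⟩, hP⟩ := P
    dsimp only at hPalg hB ⊢
    cases s with
    | zero =>
      exfalso
      exact hPtop (Subtype.ext (Prod.ext (by simp only; omega) rfl))
    | succ s =>
      have hm : a + 2 * s = 2 * p := by omega
      set η := lefschetzPowTo κ s a (2 * p) hm (primitivePart κ d (hK t) (hvan_fiberOver hf t) ⟨(a, s + 1), hP⟩ ξ)
        with hηdef
      have hηalg : η ∈ algebraicClasses (fiberOver f t) p := by
        have h := lefschetzPowTo_mem_supportedClasses hXt hKt.mem_algebraicClasses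
          (show 2 * (p + 1 - (s + 1)) = a by omega) hPalg s (2 * p) hm
        rwa [show p + 1 - (s + 1) + s = p by omega] at h
      have hηB : η = complexBetti.map (fiberι f t) (2 * p) (lefschetzPowTo K s a (2 * p) hm B) := by
        rw [hηdef, hB, map_fiberι_lefschetzPowTo t K s a (2 * p) hm B]
      have hcomap : lefschetzPowTo K s a (2 * p) hm B ∈
          (algebraicClasses (fiberOver f t) p).comap (complexBetti.map (fiberι f t) (2 * p)).hom := by
        rw [Submodule.mem_comap]
        change complexBetti.map (fiberι f t) (2 * p) (lefschetzPowTo K s a (2 * p) hm B) ∈ _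
        rw [← hηB]
        exact hηalg
      obtain ⟨a', ha', k, hk, hak⟩ := Submodule.mem_sup.1 (hprev hcomap)
      rw [LinearMap.mem_ker] at hk
      have hηa' : η = complexBetti.map (fiberι f t) (2 * p) a' := by
        rw [hηB, ← hak, map_add]
        change _ + (complexBetti.map (fiberι f t) (2 * p)).hom k = _
        rw [hk, add_zero]
      refine ⟨a', ha', fun _ ↦ ?_⟩
      rw [← lefschetzPowTo_lefschetzPowTo κ 1 hm h2 hP, map_fiberι_lefschetzPowTo t K 1 (2 * p) (2 * (p + 1)) h2 a', ← hηa']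
  choose a' ha' hcomp' using hcomp
  refine ⟨∑ P ∈ Finset.univ.erase top, a' P, Submodule.sum_mem _ fun P _ ↦ ha' P, ?_⟩
  have hsum := sum_lefschetzPowTo_primitivePart (hK t) (hvan_fiberOver hf t) ξ
  rw [← Finset.add_sum_erase _ _ (Finset.mem_univ top)] at hsum
  have htop0 : lefschetzPowTo κ top.1.2 top.1.1 (2 * (p + 1)) top.2 (primitivePart κ d (hK t) (hvan_fiberOver hf t) top ξ) =
      primitivePart κ d (hK t) (hvan_fiberOver hf t) top ξ := lefschetzPowTo_zero_apply κ (2 * (p + 1)) _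
  rw [htop0] at hsum
  rw [map_sum, map_sum, ← Finset.sum_congr rfl fun P hP ↦ hcomp' P (Finset.mem_erase.1 hP).1]
  exact hsum.symm

/-! ## §2 THE PRIMITIVE LIFT FROM THE FIBRE-SUPPORTED CLAUSE -/

/-- **(Prim)_t(p+1) FROM THE FIBRE-SUPPORTED CLAUSE.** Let `f : 𝒳 ⟶ S` be a compact pencil of abelian `d`-folds, `t` ANY point, `D` a
Kähler–rational datum of `𝒳` (`K = D.Hη`) whose restrictions have the hard Lefschetz property on the fibres and polarise `X_t`, `2(p+1) + m = d`.
Assume Kleiman's clause `A(X_t, κ)` below `p + 1` (free for abelian fibres), the lift (L)_t(p), and the clause of `A_{p+1}(𝒳, K)` ONLY ON THE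
GYSIN IMAGES OF THE PRIMITIVE INVARIANT ALGEBRAIC CLASSES OF THE FIBRE: for every `ξ ∈ P^{2p+2}_κ(X_t) ∩ N^{p+1}(X_t) ∩ Im j_t^*` there is an
ALGEBRAIC `x ∈ N^{p+1}(𝒳)` with `L_K^{m+1} x = j_{t*}(L_κᵐ ξ)` (by hard Lefschetz such an `x ∈ H^{2p+2}(𝒳)` exists uniquely; the clause asks it
to be algebraic). Then (Prim)_t(p+1). PROOF as in part XXIII-c, except that `M W ∈ N^{p+1}(𝒳)` (for `j^*W` algebraic) is now obtained by
splitting `j^*W = pr j^*W + κ ∪ j^*a`, `a ∈ Nᵖ(𝒳)` ((L)_t(p), Deligne, Kleiman — `exists_coprimitive_eq_map_lefschetzPowTo`): the clause gives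
`N(pr j^*W)` algebraic, and `N(κ ∪ j^*a) = θ(j_* L_κ^{m+1} j^*a) = θ(L_K^{m+1}([X_t] ∪ a)) = [X_t] ∪ a` is algebraic.
[cite: Grothendieck1968, §3 p. 196 (A(X))] [cite: Kleiman1968AlgebraicCycles, §3] [cite: VoisinHodgeI2002, §6.3.2 Thm. 6.32 and §6.2.3 Cor. 6.26]
[cite: VoisinHodgeII2003, §4.3.1 Thm. 4.18 and §9.2.4 Prop. 9.20] -/
theorem primitiveLift_succ_of_fibreLefschetzDegree (hf : IsCompactAbelianPencil f d) (t : ComplexPoints S)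
    (D : KaehlerRationalDatum (d + 1) 𝒳)
    (hK : ∀ s : ComplexPoints S, HasHardLefschetzProperty (complexBetti.map (fiberι f s) 2 D.Hη) d)
    (hKt : IsPolarizationClass d (fiberOver f t) (complexBetti.map (fiberι f t) 2 D.Hη)) {p m : ℕ}
    (hpm : 2 * (p + 1) + m = d)
    (hA : ∀ (p' r' q' : ℕ), p' < p + 1 → p' + (p + 1) ≤ d → 2 * p' + r' = d → p' + r' = q' →
      Set.SurjOn (lefschetzPow (complexBetti.map (fiberι f t) 2 D.Hη) r' (2 * p'))
        (algebraicClasses (fiberOver f t) p' : Set (complexBetti (fiberOver f t) (2 * p')))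
        (supportedClasses (fiberOver f t) (2 * p' + 2 * r') q'))
    (hprev : (algebraicClasses (fiberOver f t) p).comap (complexBetti.map (fiberι f t) (2 * p)).hom ≤
      algebraicClasses 𝒳 p ⊔ LinearMap.ker (complexBetti.map (fiberι f t) (2 * p)).hom)
    (hAfib : ∀ ξ ∈ algebraicClasses (fiberOver f t) (p + 1),
      ξ ∈ primitiveClasses (complexBetti.map (fiberι f t) 2 D.Hη) d (2 * (p + 1)) →
      ξ ∈ LinearMap.range (complexBetti.map (fiberι f t) (2 * (p + 1))).hom →
      ∃ x ∈ algebraicClasses 𝒳 (p + 1),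
        lefschetzPowTo D.Hη (m + 1) (2 * (p + 1)) (2 * (p + 1 + m + 1)) (by omega) x =
          fiberGysin hf t (p + 1 + m)
            (lefschetzPowTo (complexBetti.map (fiberι f t) 2 D.Hη) m (2 * (p + 1)) (2 * (p + 1 + m)) (by omega) ξ)) :
    ∀ ξ ∈ algebraicClasses (fiberOver f t) (p + 1),
      ξ ∈ primitiveClasses (complexBetti.map (fiberι f t) 2 D.Hη) d (2 * (p + 1)) →
      ξ ∈ LinearMap.range (complexBetti.map (fiberι f t) (2 * (p + 1))).hom →
      ξ ∈ (algebraicClasses 𝒳 (p + 1)).map (complexBetti.map (fiberι f t) (2 * (p + 1))).hom := by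
  classical
  intro ξ hξalg hξP hξI
  have h𝒳 := hf.isSmoothProjective_total
  have hXt := hf.isSmoothProjective_fiberOver t
  haveI := finite_complexBetti hXt (2 * (p + 1))
  set K := D.Hη with hKdef
  have hKalg : K ∈ algebraicClasses 𝒳 1 := (isPolarizationClass_Hη h𝒳 D).mem_algebraicClasses
  set κ := complexBetti.map (fiberι f t) 2 K with hκdef
  -- hard Lefschetz on `𝒳`: `θ = (L_K^{m+1})⁻¹ : H^{2(p+1+m+1)}(𝒳) → H^{2(p+1)}(𝒳)`
  have hbij : Function.Bijective (lefschetzPowTo K (m + 1) (2 * (p + 1)) (2 * (p + 1 + m + 1)) (by omega)) :=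
    bijective_lefschetzPowTo_of_hasHardLefschetz K (isPolarizationClass_Hη h𝒳 D).hasHardLefschetz
      (by omega : 2 * (p + 1) + (m + 1) = d + 1) _ _
  set Le := LinearEquiv.ofBijective _ hbij with hLe
  set θ : complexBetti 𝒳 (2 * (p + 1 + m + 1)) →ₗ[ℂ] complexBetti 𝒳 (2 * (p + 1)) := Le.symm.toLinearMap with hθdef
  have hθ : ∀ y, lefschetzPowTo K (m + 1) (2 * (p + 1)) (2 * (p + 1 + m + 1)) (by omega) (θ y) = y :=
    fun y ↦ Le.apply_symm_apply y
  have hθ' : ∀ x, θ (lefschetzPowTo K (m + 1) (2 * (p + 1)) (2 * (p + 1 + m + 1)) (by omega) x) = x :=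
    fun x ↦ Le.symm_apply_apply x
  -- the operators `N = θ j_* L_κᵐ`, `M = N j^*`, `pr`, `Ψ = pr j^* N`
  set Lκ := lefschetzPowTo κ m (2 * (p + 1)) (2 * (p + 1 + m)) (by omega) with hLκ
  let N : complexBetti (fiberOver f t) (2 * (p + 1)) →ₗ[ℂ] complexBetti 𝒳 (2 * (p + 1)) :=
    θ ∘ₗ fiberGysin hf t (p + 1 + m) ∘ₗ Lκ
  have hN : ∀ x, N x = θ (fiberGysin hf t (p + 1 + m) (Lκ x)) := fun _ ↦ rfl
  let M : Module.End ℂ (complexBetti 𝒳 (2 * (p + 1))) := N ∘ₗ (complexBetti.map (fiberι f t) (2 * (p + 1))).hom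
  have hM : ∀ W, M W = N (complexBetti.map (fiberι f t) (2 * (p + 1)) W) := fun _ ↦ rfl
  let top : {P : ℕ × ℕ // P.1 + 2 * P.2 = 2 * (p + 1)} := ⟨(2 * (p + 1), 0), by omega⟩
  let pr : complexBetti (fiberOver f t) (2 * (p + 1)) →ₗ[ℂ] complexBetti (fiberOver f t) (2 * (p + 1)) :=
    primitivePart κ d (hK t) (hvan_fiberOver hf t) top
  have hpr : ∀ x, pr x = primitivePart κ d (hK t) (hvan_fiberOver hf t) top x := fun _ ↦ rfl
  let Ψ : Module.End ℂ (complexBetti (fiberOver f t) (2 * (p + 1))) :=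
    pr ∘ₗ (complexBetti.map (fiberι f t) (2 * (p + 1))).hom ∘ₗ N
  have hΨ : ∀ x, Ψ x = pr (complexBetti.map (fiberι f t) (2 * (p + 1)) (N x)) := fun _ ↦ rfl
  -- (1) `M` maps classes with algebraic fibre restriction to ALGEBRAIC classes: the fibre-supported clause on the PRIMITIVE part,
  -- the lift (L)_t(p) on the COPRIMITIVE part (`N(κ ∪ j^*a) = [X_t] ∪ a`)
  have hF : fiberGysin hf t 0 (singularCohomology.one ℂ (ComplexPoints (fiberOver f t))) ∈ algebraicClasses 𝒳 (0 + 1) :=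
    fiberGysin_one_mem_algebraicClasses hf t
  have hMalg : ∀ W : complexBetti 𝒳 (2 * (p + 1)),
      complexBetti.map (fiberι f t) (2 * (p + 1)) W ∈ algebraicClasses (fiberOver f t) (p + 1) →
        M W ∈ algebraicClasses 𝒳 (p + 1) := by
    intro W hW
    obtain ⟨a, ha, hdec⟩ := exists_coprimitive_eq_map_lefschetzPowTo hf t hK hKt hA hprev W hW
    -- primitive part
    have hprP : pr (complexBetti.map (fiberι f t) (2 * (p + 1)) W) ∈ primitiveClasses κ d (2 * (p + 1)) :=
      primitivePart_mem (hK t) (hvan_fiberOver hf t) top _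
    have hprA : pr (complexBetti.map (fiberι f t) (2 * (p + 1)) W) ∈ algebraicClasses (fiberOver f t) (p + 1) := by
      have h := primitivePart_mem_supportedClasses_of_surjOn_lt hXt hKt.mem_algebraicClasses (hK t) (hvan_fiberOver hf t)
        (p + 1) hA _ hW top
      exact h
    have hprI : pr (complexBetti.map (fiberι f t) (2 * (p + 1)) W) ∈
        LinearMap.range (complexBetti.map (fiberι f t) (2 * (p + 1))).hom := by
      obtain ⟨B, hB⟩ : ∃ B : complexBetti 𝒳 (2 * (p + 1)), pr (complexBetti.map (fiberι f t) (2 * (p + 1)) W) =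
          complexBetti.map (fiberι f t) (2 * (p + 1)) B :=
        exists_primitivePart_map_fiberι_eq deligne1968_invariantClass_fromTotalSpace_holds hf K hK W top t
      exact ⟨B, hB.symm⟩
    obtain ⟨x, hx, hxe⟩ := hAfib _ hprA hprP hprI
    have h1 : N (pr (complexBetti.map (fiberι f t) (2 * (p + 1)) W)) = x := by
      rw [hN, ← hxe, hθ']
    -- coprimitive part `j^*(L_K a)`: `N(j^*(L_K a)) = [X_t] ∪ a`
    have h2p : 2 * p + 2 * (0 + 1) = 2 * (p + 1) := by ring
    have h2 : N (complexBetti.map (fiberι f t) (2 * (p + 1)) (lefschetzPowTo K 1 (2 * p) (2 * (p + 1)) (by omega) a)) =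
        cupProduct h2p a (fiberGysin hf t 0 (singularCohomology.one ℂ (ComplexPoints (fiberOver f t)))) := by
      rw [hN, hLκ, ← map_fiberι_lefschetzPowTo t K m (2 * (p + 1)) (2 * (p + 1 + m)) _,
        lefschetzPowTo_lefschetzPowTo K m (show 2 * p + 2 * 1 = 2 * (p + 1) by omega)
          (show 2 * (p + 1) + 2 * m = 2 * (p + 1 + m) by omega) (show 2 * p + 2 * (1 + m) = 2 * (p + 1 + m) by omega),
        lefschetzPowTo_congr_exponent K (show 1 + m = m + 1 by omega) _
          (show 2 * p + 2 * (m + 1) = 2 * (p + 1 + m) by omega),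
        fiberGysin_map_fiberι_eq_cupProduct hf t,
        cupProduct_lefschetzPowTo_left K (m + 1) (show 2 * p + 2 * (m + 1) = 2 * (p + 1 + m) by omega)
          (show 2 * (p + 1 + m) + 2 * (0 + 1) = 2 * (p + 1 + m + 1) by ring) h2p
          (show 2 * (p + 1) + 2 * (m + 1) = 2 * (p + 1 + m + 1) by omega), hθ']
    have halg2 : cupProduct h2p a (fiberGysin hf t 0 (singularCohomology.one ℂ (ComplexPoints (fiberOver f t)))) ∈
        algebraicClasses 𝒳 (p + 1) :=
      Theorems.Voisin2003_cupProduct_algebraicClasses_holds h𝒳 ha hF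
    rw [hM, hdec, map_add, h1, h2]
    exact Submodule.add_mem _ hx halg2
  have hMpow : ∀ (l : ℕ) (W : complexBetti 𝒳 (2 * (p + 1))),
      complexBetti.map (fiberι f t) (2 * (p + 1)) W ∈ algebraicClasses (fiberOver f t) (p + 1) →
        (M ^ (l + 1)) W ∈ algebraicClasses 𝒳 (p + 1) := by
    intro l
    induction l with
    | zero => intro W hW; rw [zero_add, pow_one]; exact hMalg W hW
    | succ l ih =>
      intro W hW
      rw [pow_succ', Module.End.mul_apply]
      exact hMalg _ (algebraicClasses_sup_ker_le_comap hf (p + 1) t (Submodule.mem_sup_left (ih W hW)))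
  -- (2) `Φ = j^* N` kills the coprimitive invariant classes
  have hΦcop : ∀ (a s : ℕ) (hP : a + 2 * (s + 1) = 2 * (p + 1)) (B : complexBetti 𝒳 a),
      complexBetti.map (fiberι f t) (2 * (p + 1))
        (N (lefschetzPowTo κ (s + 1) a (2 * (p + 1)) hP (complexBetti.map (fiberι f t) a B))) = 0 := by
    intro a s hP B
    have h2 : 2 * p + 2 * (0 + 1) = 2 * (p + 1) := by ring
    -- `L_κᵐ L_κ^{s+1} j^*B = j^* L_K^{m+1} L_Kˢ B`
    have hLL : Lκ (lefschetzPowTo κ (s + 1) a (2 * (p + 1)) hP (complexBetti.map (fiberι f t) a B)) =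
        complexBetti.map (fiberι f t) (2 * (p + 1 + m))
          (lefschetzPowTo K (m + 1) (2 * p) (2 * (p + 1 + m)) (by omega) (lefschetzPowTo K s a (2 * p) (by omega) B)) := by
      rw [hLκ, lefschetzPowTo_lefschetzPowTo κ m hP (show 2 * (p + 1) + 2 * m = 2 * (p + 1 + m) by omega)
          (show a + 2 * (s + 1 + m) = 2 * (p + 1 + m) by omega),
        lefschetzPowTo_lefschetzPowTo K (m + 1) (show a + 2 * s = 2 * p by omega)
          (show 2 * p + 2 * (m + 1) = 2 * (p + 1 + m) by omega) (show a + 2 * (s + (m + 1)) = 2 * (p + 1 + m) by omega),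
        map_fiberι_lefschetzPowTo t K (s + (m + 1)) a (2 * (p + 1 + m)) _ B]
      exact lefschetzPowTo_congr_exponent κ (by omega) _ _ _
    rw [hN, hLL, fiberGysin_map_fiberι_eq_cupProduct hf t,
      cupProduct_lefschetzPowTo_left K (m + 1) (show 2 * p + 2 * (m + 1) = 2 * (p + 1 + m) by omega)
        (show 2 * (p + 1 + m) + 2 * (0 + 1) = 2 * (p + 1 + m + 1) by ring) h2
        (show 2 * (p + 1) + 2 * (m + 1) = 2 * (p + 1 + m + 1) by omega), hθ']
    change complexBetti.map (fiberι f t) (2 * (p + 1)) (cupProduct h2 _ _) = 0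
    rw [show complexBetti.map (fiberι f t) (2 * (p + 1))
        (cupProduct h2 (lefschetzPowTo K s a (2 * p) (by omega) B)
          (fiberGysin hf t 0 (singularCohomology.one ℂ (ComplexPoints (fiberOver f t))))) =
        cupProduct h2 (complexBetti.map (fiberι f t) (2 * p) (lefschetzPowTo K s a (2 * p) (by omega) B))
          (complexBetti.map (fiberι f t) (2 * (0 + 1))
            (fiberGysin hf t 0 (singularCohomology.one ℂ (ComplexPoints (fiberOver f t))))) from
        cupProduct_map _ h2 _ _,
      map_fiberι_fiberGysin_one_eq_zero hf t t, map_zero]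
  have hΦpr : ∀ W : complexBetti 𝒳 (2 * (p + 1)),
      complexBetti.map (fiberι f t) (2 * (p + 1)) (N (complexBetti.map (fiberι f t) (2 * (p + 1)) W)) =
        complexBetti.map (fiberι f t) (2 * (p + 1)) (N (pr (complexBetti.map (fiberι f t) (2 * (p + 1)) W))) := by
    intro W
    conv_lhs => rw [← sum_lefschetzPowTo_primitivePart (hK t) (hvan_fiberOver hf t)
      (complexBetti.map (fiberι f t) (2 * (p + 1)) W)]
    rw [map_sum, map_sum, Finset.sum_eq_single top]
    · rw [hpr]
      exact congrArg _ (congrArg _ (lefschetzPowTo_zero_apply κ (2 * (p + 1)) _))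
    · intro P _ hP
      obtain ⟨B, hB⟩ : ∃ B : complexBetti 𝒳 P.1.1, primitivePart κ d (hK t) (hvan_fiberOver hf t) P
          (complexBetti.map (fiberι f t) (2 * (p + 1)) W) = complexBetti.map (fiberι f t) P.1.1 B :=
        exists_primitivePart_map_fiberι_eq deligne1968_invariantClass_fromTotalSpace_holds hf K hK W P t
      obtain ⟨⟨a, s⟩, hP'⟩ := P
      cases s with
      | zero =>
        exfalso
        exact hP (Subtype.ext (Prod.ext (by simp only; omega) rfl))
      | succ s =>
        dsimp only at hB ⊢
        rw [hB]
        exact hΦcop a s hP' B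
    · intro h
      exact absurd (Finset.mem_univ _) h
  -- (3) `Ψ` maps into `E = P ∩ Im j^*` and is injective there (§4); Cayley–Hamilton
  let E : Submodule ℂ (complexBetti (fiberOver f t) (2 * (p + 1))) :=
    primitiveClasses κ d (2 * (p + 1)) ⊓ LinearMap.range (complexBetti.map (fiberι f t) (2 * (p + 1))).hom
  have hξE : ξ ∈ E := ⟨hξP, hξI⟩
  have hΨE : ∀ x, Ψ x ∈ E := by
    intro x
    refine ⟨primitivePart_mem (hK t) (hvan_fiberOver hf t) top _, ?_⟩
    obtain ⟨B, hB⟩ : ∃ B : complexBetti 𝒳 (2 * (p + 1)), pr (complexBetti.map (fiberι f t) (2 * (p + 1)) (N x)) =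
        complexBetti.map (fiberι f t) (2 * (p + 1)) B :=
      exists_primitivePart_map_fiberι_eq deligne1968_invariantClass_fromTotalSpace_holds hf K hK (N x) top t
    exact ⟨B, hB.symm⟩
  let ΨE : Module.End ℂ E := Ψ.restrict fun x _ ↦ hΨE x
  have hΨE_val : ∀ x : E, ((ΨE x : E) : complexBetti (fiberOver f t) (2 * (p + 1))) = Ψ x := fun _ ↦ rfl
  have hinj : Function.Injective ΨE := by
    refine (injective_iff_map_eq_zero ΨE).2 fun x hx ↦ Subtype.ext ?_
    have hx' : Ψ x = 0 := by rw [← hΨE_val, hx]; rfl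
    exact eq_zero_of_primitivePart_restrict_lift_eq_zero hf t D hK (r := p + 1) (by omega) θ hθ x.2.1 x.2.2 hx'
  obtain ⟨sF, dF, hCH⟩ := exists_sum_smul_pow_comp_eq_id ΨE hinj
  -- the iterates: `Ψˡ ξ = pr j^* (Mˡ W₀)`
  obtain ⟨W₀, hW₀⟩ := hξI
  have hW₀' : complexBetti.map (fiberι f t) (2 * (p + 1)) W₀ = ξ := hW₀
  have hiter : ∀ l : ℕ, (((ΨE ^ l) ⟨ξ, hξE⟩ : E) : complexBetti (fiberOver f t) (2 * (p + 1))) =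
      pr (complexBetti.map (fiberι f t) (2 * (p + 1)) ((M ^ l) W₀)) := by
    intro l
    induction l with
    | zero =>
      rw [pow_zero, pow_zero, Module.End.one_apply, Module.End.one_apply, hW₀']
      change ξ = pr ξ
      have h := primitivePart_lefschetzPowTo_of_mem (hK t) (hvan_fiberOver hf t) top (by simp only [top]; omega) hξP
      have h0 : lefschetzPowTo κ top.1.2 top.1.1 (2 * (p + 1)) top.2 ξ = ξ := lefschetzPowTo_zero_apply κ (2 * (p + 1)) ξ
      rw [h0] at h
      rw [hpr]
      exact h.symm
    | succ l ih =>
      rw [pow_succ', pow_succ', Module.End.mul_apply, Module.End.mul_apply]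
      change Ψ (((ΨE ^ l) ⟨ξ, hξE⟩ : E) : complexBetti (fiberOver f t) (2 * (p + 1))) = _
      rw [ih, hΨ, ← hΦpr, ← hM]
  -- `ξ = pr j^* W'` with `W'` ALGEBRAIC
  set W' := ∑ k ∈ sF, dF k • (M ^ (k + 1)) W₀ with hW'
  have hW'alg : W' ∈ algebraicClasses 𝒳 (p + 1) :=
    Submodule.sum_mem _ fun k _ ↦ Submodule.smul_mem _ _ (hMpow k W₀ (by rw [hW₀']; exact hξalg))
  have hξW' : ξ = pr (complexBetti.map (fiberι f t) (2 * (p + 1)) W') := by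
    have h := congrArg (fun g : Module.End ℂ E ↦ ((g ⟨ξ, hξE⟩ : E) : complexBetti (fiberOver f t) (2 * (p + 1)))) hCH
    simp only [LinearMap.comp_apply, LinearMap.id_apply, LinearMap.coe_sum, Finset.sum_apply, LinearMap.smul_apply,
      Submodule.coe_sum, Submodule.coe_smul] at h
    rw [← h, hW', map_sum, map_sum]
    refine Finset.sum_congr rfl fun k _ ↦ ?_
    rw [map_smul, map_smul, ← hiter (k + 1), pow_succ, Module.End.mul_apply]
  -- (4) the top primitive part of `j^*W'` lifts (§5)
  rw [hξW', hpr]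
  exact primitivePart_top_map_fiberι_mem_map hf t hKalg hK hKt hA hprev hW'alg


end Main


end Summit.HodgeConjecture.HodgeConjecture.Ring2.AbelianAll

end
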